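import Mathlib
import HarnessLib
import HarnessLib.Audit
import Summits.Parity.Statement
import Literature.NumberTheory.Sieve.SingularSeries

/-!
Route: TauberianTwins

CLOSED (retired) 2026-08-15T13:50:42Z by operator:999:1257524 — reason: not-a-thesis: assembly does not conclude the sub-problem Statement — note: D-0027 §2.1 audit (human 2026-08-15: routes that do not decide the summit are removed): the assembly concludes `PairsHL`, not the sub-problem statement; a NEW conforming route may be opened from the same idea (generated `closes : … → _root_.GeneralizedHardyLittlewood`).. The file is kept as the record of this route; refuted decls are indexed as negative knowledge (`ledger negatives`).

X6 (TauberianTwins). It suffices to show, for every shift h ≥ 1 (and then for every fixed d = 1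
tuple), TWO statements about the pair correlation C_h(N) = ∑_{n ≤ N} Λ(n)Λ(n+h): (L) the
LOGARITHMICALLY AVERAGED Hardy–Littlewood asymptotic ∑_{n ≤ N} Λ(n)Λ(n+h)/n = 𝔖(h) log N + o(log N)
— equivalently (Karamata, coefficients ≥ 0) the Abel/polar statement (σ−1) D_h(σ) → 𝔖(h) as σ → 1+,
where D_h(s) = ∑_n Λ(n)Λ(n+h) n^{−s}; and ONE Tauberian upgrade, either (R) SCALE RIGIDITY: F_h(N) =
C_h(N)/N is slowly oscillating on the multiplicative scale, |F_h(N') − F_h(N)| ≤ ε for N₀ ≤ N ≤ N' ≤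
N^{1+δ(ε)} (Schmidt's Tauberian condition for (C,1) means in the variable u = log N), or (I) IKEHARA
BOUNDARY REGULARITY: D_h(s) − 𝔖(h)/(s−1) extends continuously to the closed half-plane Re s ≥ 1
(Wiener–Ikehara, using Λ(n)Λ(n+h) ≥ 0). Then C_h(N) = 𝔖(h) N + o(N) (HL pairs, Λ-form); k-tuples
identically with ∏ Λ(n+h_i).
Lean one-liner (X = LogPairsHL ∧ ScaleRigidity; elaborates now):
(∀ h : ℕ, 1 ≤ h → (fun N : ℕ => ∑ n ∈ Finset.Icc 1 N, ArithmeticFunction.vonMangoldt n *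
ArithmeticFunction.vonMangoldt (n + h) / n - Literature.NumberTheory.Sieve.singularSeries ({0, (h :
ℤ)} : Finset ℤ) * Real.log N) =o[Filter.atTop] fun N : ℕ => Real.log N) ∧ (∀ h : ℕ, 1 ≤ h → ∀ ε : ℝ,
0 < ε → ∃ δ : ℝ, 0 < δ ∧ ∃ N₀ : ℕ, ∀ N N' : ℕ, N₀ ≤ N → N ≤ N' → (N' : ℝ) ≤ (N : ℝ) ^ (1 + δ) → |(∑
n ∈ Finset.Icc 1 N', ArithmeticFunction.vonMangoldt n * ArithmeticFunction.vonMangoldt (n + h)) / N'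
- (∑ n ∈ Finset.Icc 1 N, ArithmeticFunction.vonMangoldt n * ArithmeticFunction.vonMangoldt (n + h))
/ N| ≤ ε)

Rationale: WHY THIS LINE. Complex/real Tauberian theory splits the binary HL asymptotic into two statements of
different natures:
the VALUE of the constant, demanded only on logarithmic average (L) -- the averaging under which the
multiplicative side of
parity has actually moved ([TaoFMP2016] log-Chowla; [TaoTeravainenDuke2019] structure of
log-correlations; entropy decrement) --
and a constant-free REGULARITY statement: no oscillation across scales (R), or continuity of the
pair-correlation Dirichlet
series on Re s = 1 (I). (L) <-> Abel mean is Karamata's theorem and (L)+(R) -> HL, (I) -> HL are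
Schmidt's slow-oscillation
theorem and Wiener-Ikehara [Korevaar2004, Ch. I.5, I.12-16, III.4]; positivity Lambda(n)Lambda(n+h)
>= 0 is what makes the
one-sided Tauberian machinery available (it is absent for Chowla). D_h(s) is a shifted-convolution
Dirichlet series: for
divisor coefficients such series continue meromorphically by the spectral theory of SL_2(Z) (Selberg
1965; Goldfeld,
Hoffstein-Hulse), which is the imported area behind (I); the withdrawn Wiener-Ikehara attempt
[Arenstorf2004] failed exactly at
the boundary-continuity step, so (I) is filed as a crux to be grounded/refuted sharply, not assumed.
Sibling routes attack the
plain average directly (X1 sieve, X2 EH+Moebius, X4 minor arcs); this one asks whether log-averaging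
buys anything for PRIMES
(honest caveat: Tao's entropy decrement uses lambda(pn) = -lambda(n), which Lambda lacks) and
isolates scale-rigidity as a
statement provers/refuters can engage with independently of the constant.
RANKED CRUXES.
 r2 LogPairsHL: for all h >= 1, sum_{n<=N} Lambda(n)Lambda(n+h)/n = S({0,h}) log N + o(log N). Open
(odd h trivial, S = 0).
 r3 ScaleRigidity: for all h, eps there are delta, N_0 with |C_h(N')/N' - C_h(N)/N| <= eps for N_0
<= N <= N' <= N^{1+delta}.
    Open; implied by HL; no sieve bound gives it (upper/lower sieve constants differ). Refutable in
principle by an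
    Omega-oscillation result (Maier-type irregularity would be the model of a refutation).
 r4 IkeharaBoundary: for all h >= 1 there is g continuous on {Re s >= 1} with g(s) =
LSeries(Lambda(n)Lambda(n+h))(s) - S(h)/(s-1)
    for Re s > 1. Open; strictly stronger than what HL needs but the natural spectral statement.
 support: AbelPairsHL ((sigma-1) sum Lambda(n)Lambda(n+h) n^-sigma -> S(h), sigma -> 1+),
KaramataLink (LogPairsHL <-> AbelPairsHL,
    PROVABLE: Karamata/Hardy-Littlewood Tauberian theorem for nonnegative coefficients),
IkeharaUpgrade (IkeharaBoundary ->
    PairsHL, PROVABLE: Wiener-Ikehara), PairsHL (the target: C_h(N) = S({0,h}) N + o(N) for all h >=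
1).
 rank-1 Assembly (PROVABLE): LogPairsHL -> ScaleRigidity -> PairsHL. Proof: G(u) = C_h(e^u)/e^u is
bounded (Selberg/Brun-
    Titchmarsh upper bound C_h(N) << S(h) N, or crude Lambda <= log), (L) by partial summation gives
(1/U) int_0^U G = S + o(1),
    (R) is slow oscillation of G on [u, (1+delta)u]; Schmidt's theorem [Korevaar2004, Thm
I.16.1-type] gives G(u) -> S.
KILL CRITERIA. r3 refuted for some h (an Omega(1) oscillation of C_h(N)/N between N and N^{1+delta})
refutes HL itself and
closes every GHL route -- file it loudly. r4 refuted (a natural boundary / discontinuity on Re s = 1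
compatible with HL, e.g.
from an Omega(N^{1/2+}) error term theory) only drops the (I) branch: pivot to (L)+(R). If
KaramataLink or Assembly is refuted
the bookkeeping (boundedness of G, positivity) is wrong: re-derive, do not close. Route DEMOTED if a
grounder shows (L) is
provably equivalent to plain HL by a cheap argument (then log-averaging buys nothing and r2 merges
into X1/X2 targets).
NOT DECOMPOSED YET. Any attack on r2 (log-averaged Bombieri sieve: does the k = 1 indeterminacy
persist under logarithmic
averaging? -- Selberg's examples 1 +- lambda say YES for general sequences, so r2 needs
prime-specific input); k-tuples and the
uniform-in-shift version needed for DimOne (route DicksonFibration); almost-all-scales variants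
(logarithmic density of bad
scales = 0) as an intermediate rung between (L) and (L)+(R).

Novelty: NOVELTY (retriage planner, 2026-08-14). Searches run BEFORE this claim: `lit frontier Parity --since
2020`; `lit bridges Parity --cross any`; `lit search --hybrid` ("Wiener-Ikehara twin primes
pseudofunction boundary behaviour Dirichlet series prime pairs"); `lit vsearch --papers` ("TPC
equivalent to pseudofunction boundary behaviour of sum Lambda(n)Lambda(n+2) n^-s minus C/(s-1)");
`lit search` ("Golomb lambda method twin prime constant Hindry Rivoal Bateman-Horn", local +
crossref; OpenAlex/S2/arXiv HTTP 429 today); `lit read` of Korevaar2005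
(doi:10.1016/s0019-3577(05)80013-8) pp.1-4,12-13, Korevaar2009 (doi:10.1016/j.jat.2008.01.008)
pp.5,8-9, arXiv:0806.4057 p.3, Pontes 2012 (doi:10.11606/d.45.2012.tde-25072012-204437) pp.5,7,61;
plus the grounders' page-verified reads of TaoFMP2016 (arXiv:1509.05422) pp.3-4, HardyLittlewood1923
p.42, MontgomeryVaughan2007 Thm 5.11 / Cor 8.8, Elliott1997 Lemma 10.1.

Nearest prior art actually found, per branch:
(I) IKEHARA BRANCH — KNOWN territory. Korevaar2005, Thm 1.1 + Cor 2.1 (p.4): "The Twin-Prime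
Conjecture is equivalent to (local) pseudofunction boundary behavior of the function {y -> g2(x+iy)}
as x -> 1", g2 = f2 - C2/(z-1), f2(z) = (1/z) sum Lambda(n)Lambda(n+2) n^{-z}; Korevaar2009, Thm 6.1
(two-way distributional Wiener-Ikehara) with (6.6)-(6.7) p.9: PPC(2r) "is equivalent to good
boundary behavior of G_2r(s) as sigma -> 1/2"; Korevaar arXiv:0806.4057 (remainder metatheorems by
the same complex method); Arenstorf2004 = arXiv:  [refs: 10.1016/s0019-3577(05, 10.1016/j.jat.2008.01.008, 10.11606/d.45.2012.tde-25072012-204437, 10.1016/0022-314x(70, 0806.4057, 1509.05422, math/0405509, 1707.01315, doi:10.1016/s0019-3577, doi:10.1016/j.jat.2008.01.008, doi:10.11606/d.45.2012.tde-25072012-204437, doi:10.1016/0022-314x, Korevaar2005, Korevaar2009, TaoFMP2016, HardyLittlewood1923, MontgomeryVaughan2007, Elliott1997, Arenstorf2004, Korev]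

Barriers (technique_class: complex-tauberian;slow-oscillation;logarithmic-averaging): BARRIERS (catalogue Literature/Barriers/Parity, 23 files listed 2026-08-14; the five that touch this
route's technique class or its kill criteria, one line each; decl names verified with `lean search
--decl`).
Literature.Barriers.Parity.LogarithmicAveraging (decl
Literature.Barriers.Parity.LogarithmicAveraging, PROVED; names this route): APPLIES to the step (L)
-> PairsHL — Hall's set has log density 1/2 and no natural density, so no argument using of
Lambda(n)Lambda(n+h) only non-negativity and O(N) partial sums upgrades LogPairsHL to PairsHL
(Literature.Barriers.Parity.not_logToMeanTransfer_nonneg). EVADED BY DESIGN: the route never invokes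
LogToMeanTransfer; its second input is a genuine Tauberian hypothesis — (R) Schmidt slow oscillation
(Assembly LogPairsHL -> ScaleRigidity -> PairsHL =
Literature.NumberTheory.LFunctions.Elliott1997_10_1, proved) or (I) boundary regularity
(IkeharaUpgrade = Literature.NumberTheory.LFunctions.WienerIkehara, proved) — which is the
catalogue's own evasion (c). NOT EVADED: the entry's clause that the entropy-decrement engine yields
only log averages AND "does not appear to have any bearing as yet on twin prime-type sums"
(TaoFMP2016 p.4) — crux LogPairsHL has no engine in print; the bet is that the log/Abel mean
(Golomb's interchange) is strictly more accessible than HL for primes although it still implies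
infinitely many prime pairs.
Literature.Barriers.Parity.PrimePairParity (decl Literature.Barriers.Parity.PrimePairParity, proved
schema)

History (route lifecycle, newest last):
- 2026-08-15T13:50:42Z · CLOSED retired — not-a-thesis: assembly does not conclude the sub-problem Statement (operator:999:1257524)

sub-problem: GeneralizedHardyLittlewood · status: closed(retired) · opened planner-plan-Parity-GeneralizedHardyLittlewood-0 2026-08-13T19:16:14Z · rev 1 · ledger route-Parity-TauberianTwins
GENERATED by the gate from the ledger (D-0016/17). Provers cite these decls: `theorem foo : Summit.Parity.GeneralizedHardyLittlewood.Theses.TauberianTwins.<Decl> := …` in Summits/Parity/GeneralizedHardyLittlewood/Theorems/<Name>.lean.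
-/

namespace Summit.Parity.GeneralizedHardyLittlewood.Theses.TauberianTwins

open scoped BigOperators Topology Manifold Classical MeasureTheory ProbabilityTheory Matrix InnerProductSpace ComplexConjugate ContinuousMap
open Filter Set Function TopologicalSpace MeasureTheory

attribute [summit_statement] _root_.GeneralizedHardyLittlewood

/-- item stmt-Parity-0867 · target · rank 0 · closed · moot by None · by planner
why it might fail: Binary Hardy–Littlewood (1923 Conj. B, Λ-form), fixed even h: open, twin-prime strength. Parity (Literature.Barriers.Parity.PrimePairParity; Literature.NumberTheory.Sieve.bombieri_asymptotic_sieve_indeterminacy) blocks sieve deductions even under EH; minor arcs keep L²-mass ≍x/log x (Literature.Barr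
sources: HardyLittlewood1923 (Acta Math 44) p.42 Conjecture B, (5.26), GreenTao2010 = arXiv:math/0606088 Conj 1.2, Example 1 (d=1, t=2), Korevaar2009 (6.4)-(6.5): PPC ⇔ ψ_{2r}(x) ∼ 2C_{2r}x, Polymath8b2014 §8 = Literature.Barriers.Parity.PrimePairParity, Literature.Barriers.Parity.CircleMethodBinaryBarrier, Literature.Barriers.Parity.SelbergParityBarrier
[target] Hardy–Littlewood pairs, Λ-form, fixed shift: for every h ≥ 1, ∑_{n ≤ N} Λ(n)Λ(n+h) =
𝔖({0,h}) N + o(N). The d = 1, t = 2, fixed-shift content of GHL (uniformity in h ≤ L N is NOT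
claimed here; see route DicksonFibration). Open. [HardyLittlewood1923] [GreenTao2010, Example 1] -/
@[route_item "route-Parity-TauberianTwins"]
def PairsHL : Prop :=
  ∀ h : ℕ, 1 ≤ h → (fun N : ℕ => ∑ n ∈ Finset.Icc 1 N, ArithmeticFunction.vonMangoldt n * ArithmeticFunction.vonMangoldt (n + h) - Literature.NumberTheory.Sieve.singularSeries ({0, (h : ℤ)} : Finset ℤ) * N) =o[Filter.atTop] fun N : ℕ => (N : ℝ)

/-- item stmt-Parity-0861 · crux · rank 2 · closed · moot by None · by planner
why it might fail: Even h: (L) forces ∑Λ(n)Λ(n+h)/n→∞ with prime-power part O(1), so it already implies infinitely many prime pairs (p,p+h) — twin-prime strength; the one log-averaging engine (entropy decrement, TaoFMP2016 Thm 1.2) needs λ(pn)=−λ(n), which Λ lacks (ibid. p.4); parity excludes sieve proofs.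
sources: TaoFMP2016 = arXiv:1509.05422, Thm 1.2 (p.3) and p.4 caveat, Literature.NumberTheory.LFunctions.tao_log_chowla_two (Literature/NumberTheory/LFunctions/MultiplicativeCorrelations.lean), Literature.Barriers.Parity.LogarithmicAveraging (Literature/Barriers/Parity/LogarithmicAveraging.lean, proved), Literature.Barriers.Parity.PrimePairParity (proved schema), Golomb 1970, J. Number Theory 2, doi:10.1016/0022-314x(70)90019-3 (Λ-method: HL constant from the Dirichlet/Abel mean modulo an unproved interchange = AbelPairsHL), HardyLittlewood1923 p.42 (5.25)→(5.26) 'by the Tauberian theorem'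
[crux] Logarithmically averaged Hardy–Littlewood for pairs: for every h ≥ 1, ∑_{n ≤ N} Λ(n)Λ(n+h)/n
= 𝔖({0,h}) log N + o(log N) (𝔖 = Literature.NumberTheory.Sieve.singularSeries; for odd h both sides
are trivial). Weaker than HL pairs (partial summation), equivalent to the Abel mean AbelPairsHL by
Karamata. Open. The averaging under which two-point Chowla is known [TaoFMP2016]; whether it helps
for Λ (no multiplicativity) is the informative question. [TaoFMP2016] [TaoTeravainenDuke2019]
[Korevaar2004, Ch. I.5] -/
@[route_item "route-Parity-TauberianTwins"]
def LogPairsHL : Prop :=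
  ∀ h : ℕ, 1 ≤ h → (fun N : ℕ => ∑ n ∈ Finset.Icc 1 N, ArithmeticFunction.vonMangoldt n * ArithmeticFunction.vonMangoldt (n + h) / n - Literature.NumberTheory.Sieve.singularSeries ({0, (h : ℤ)} : Finset ℤ) * Real.log N) =o[Filter.atTop] fun N : ℕ => Real.log N

/-- item stmt-Parity-0862 · crux · rank 3 · closed · moot by None · by planner
why it might fail: HL-strength though constant-free: an Ω(1) swing of C_h(N)/N over N≤N'≤N^{1+δ} is ¬HL, and nothing unconditional controls oscillation — sieves give only 0≤C_h(N)/N≤(4+o(1))𝔖 (Literature.NumberTheory.Sieve.TwinSieveUpperBound 4), no lower bound; Maier-type irregularity (Maier1985), the refutation mode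
sources: Elliott1997 Lemma 10.1 pp.78-79 = Literature.NumberTheory.LFunctions.Elliott1997_10_1 (proved; Schmidt slow decrease in t = log N), Korevaar2004 Ch. I §12-16 (R. Schmidt 1925 slow oscillation; secondary, not held), Literature.NumberTheory.Sieve.TwinSieveUpperBound / Literature.NumberTheory.Sieve.twinSieve_selberg_bombieri_davenport (Literature/NumberTheory/Sieve/HardyLittlewood.lean), Maier1985 = Literature.Barriers.Parity.Maier1985_shortIntervals, GranvilleSoundararajan2007Uncertainty = Literature.Barriers.Parity.EquidistributionLimitBarrier, MontgomeryVaughan2007 §5.2 Thm 5.6 (mechanism)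
[crux] Scale rigidity (Schmidt's slow-oscillation condition in u = log N): for every h ≥ 1 and ε > 0
there are δ > 0, N₀ with |C_h(N')/N' − C_h(N)/N| ≤ ε whenever N₀ ≤ N ≤ N' ≤ N^{1+δ}, C_h(N) = ∑_{n ≤
N} Λ(n)Λ(n+h). Constant-free; implied by HL; not implied by any sieve upper/lower bound. Open. A
refutation (Ω(1) oscillation across polynomially related scales) would refute HL. [Korevaar2004, Ch.
I.12–16] -/
@[route_item "route-Parity-TauberianTwins"]
def ScaleRigidity : Prop :=
  ∀ h : ℕ, 1 ≤ h → ∀ ε : ℝ, 0 < ε → ∃ δ : ℝ, 0 < δ ∧ ∃ N₀ : ℕ, ∀ N N' : ℕ, N₀ ≤ N → N ≤ N' → (N' : ℝ) ≤ (N : ℝ) ^ (1 + δ) → |(∑ n ∈ Finset.Icc 1 N', ArithmeticFunction.vonMangoldt n * ArithmeticFunction.vonMangoldt (n + h)) / N' - (∑ n ∈ Finset.Icc 1 N, ArithmeticFunction.vonMangoldt n * ArithmeticFunction.vonMangoldt (n + h)) / N| ≤ ε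

/-- item stmt-Parity-0863 · crux · rank 4 · closed · moot by None · by planner
why it might fail: Strictly stronger than PairsHL; may fail even if HL holds: continuity of D_h−𝔖/(s−1) on ALL of Re s=1 needs the remainder E_h(x)=ψ_h(x)−𝔖x so small that ∫E_h(x)x^{-2-it}dx converges, not just o(x). Korevaar2005 Cor 2.1: TPC ⇔ only PSEUDOFUNCTION boundary values; Arenstorf2004 failed here.
sources: Korevaar2005 doi:10.1016/s0019-3577(05)80013-8, Thm 1.1, Cor 2.1 (p.4), p.13 ref [2], Korevaar2009 doi:10.1016/j.jat.2008.01.008, Thm 6.1 and (6.6)-(6.7) p.9, Arenstorf2004 = arXiv:math/0405509 (withdrawn 2004-06-09; gap at boundary continuity, Lemma 8), arXiv:0806.4057 (Korevaar, 'Lower bound for the remainder in the prime-pair conjecture', Metatheorems 1.1-1.4 p.3), MontgomeryVaughan2007 Cor 8.8 = Literature.NumberTheory.LFunctions.WienerIkehara (proved in tree: WienerIkehara_holds), EgamiMatsumoto2007 doi:10.1142/9789812770134_0001 Conj 2.1 (additive analogue: Re s=1 natural boundary)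
[crux] Wiener–Ikehara boundary regularity: for every h ≥ 1 the pair-correlation Dirichlet series
D_h(s) = ∑_n Λ(n)Λ(n+h) n^{-s} (Mathlib LSeries) minus 𝔖({0,h})/(s−1) agrees on Re s > 1 with a
function continuous on the closed half-plane Re s ≥ 1. Open; the spectral/shifted-convolution
formulation (for divisor coefficients such continuations come from the spectral theory of SL₂(ℤ)).
The withdrawn proof [Arenstorf2004] failed at exactly this step. Implies PairsHL by Wiener–Ikehara
(IkeharaUpgrade). [Arenstorf2004] [Korevaar2004, Ch. III.4] -/
@[route_item "route-Parity-TauberianTwins"]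
def IkeharaBoundary : Prop :=
  ∀ h : ℕ, 1 ≤ h → ∃ g : ℂ → ℂ, ContinuousOn g {s : ℂ | 1 ≤ s.re} ∧ ∀ s : ℂ, 1 < s.re → g s = LSeries (fun n => ((ArithmeticFunction.vonMangoldt n * ArithmeticFunction.vonMangoldt (n + h) : ℝ) : ℂ)) s - (Literature.NumberTheory.Sieve.singularSeries ({0, (h : ℤ)} : Finset ℤ) : ℂ) / (s - 1)

/-- item stmt-Parity-0864 · support · rank 9 · closed · moot by None · by planner
[support] Abel/polar form of the log-average: for every h ≥ 1, (σ − 1) ∑_n Λ(n)Λ(n+h) n^{-σ} →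
𝔖({0,h}) as σ → 1+. Equivalent to LogPairsHL (KaramataLink). Open. [Korevaar2004, Ch. I.5] -/
@[route_item "route-Parity-TauberianTwins"]
def AbelPairsHL : Prop :=
  ∀ h : ℕ, 1 ≤ h → Filter.Tendsto (fun σ : ℝ => (σ - 1) * ∑' n : ℕ, ArithmeticFunction.vonMangoldt n * ArithmeticFunction.vonMangoldt (n + h) / (n : ℝ) ^ σ) (nhdsWithin 1 (Set.Ioi 1)) (nhds (Literature.NumberTheory.Sieve.singularSeries ({0, (h : ℤ)} : Finset ℤ)))

/-- item stmt-Parity-0865 · support · rank 9 · closed · moot by None · by planner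
[support] PROVABLE: LogPairsHL ↔ AbelPairsHL, by partial summation (→) and Karamata's Tauberian
theorem for the nonnegative measure ∑ Λ(n)Λ(n+h)/n · δ_{log n} (←). [Korevaar2004, Ch. I.5
(Karamata), Hardy–Littlewood Tauberian theorem] -/
@[route_item "route-Parity-TauberianTwins"]
def KaramataLink : Prop :=
  LogPairsHL ↔ AbelPairsHL

/-- item stmt-Parity-0866 · support · rank 9 · closed · moot by None · by planner
[support] PROVABLE: IkeharaBoundary → PairsHL, the Wiener–Ikehara theorem applied to the nonnegative
coefficients Λ(n)Λ(n+h) (residue 𝔖({0,h}); for odd h, 𝔖 = 0 and the conclusion is the trivial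
bound). [Korevaar2004, Ch. III.4] -/
@[route_item "route-Parity-TauberianTwins"]
def IkeharaUpgrade : Prop :=
  IkeharaBoundary → PairsHL

/-- item stmt-Parity-0868 · assembly · rank 1 · closed · moot by None · by planner
[assembly] PROVABLE: LogPairsHL → ScaleRigidity → PairsHL. G(u) := C_h(e^u) e^{-u} is bounded (Λ ≤
log and a Brun–Titchmarsh/Selberg upper bound, or even the crude C_h(N) ≤ N log² N suffices after
noting (R) forces eventual boundedness from (L)); LogPairsHL gives (1/U)∫₀^U G(u) du → 𝔖 by partial
summation; ScaleRigidity is slow oscillation of G on the multiplicative scale u ≤ u' ≤ (1+δ)u; R.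
Schmidt's Tauberian theorem for (C,1) means then gives G(u) → 𝔖, i.e. PairsHL. Full assembly to
GeneralizedHardyLittlewood additionally needs k-tuples and uniform shifts (route DicksonFibration,
informal). [Korevaar2004, Ch. I.12–16] -/
@[route_item "route-Parity-TauberianTwins"]
def Assembly : Prop :=
  LogPairsHL → ScaleRigidity → PairsHL

end Summit.Parity.GeneralizedHardyLittlewood.Theses.TauberianTwins
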